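import Summits.HodgeConjecture.HodgeConjecture.Theorems.Ring2WeilCoverageTypeNormSignPrincipal
import HarnessLib

/-!
# Weil-type family coverage — FULL UNIT SIGNATURE: THEOREM L (ii) plus ONE real unit negative at an odd number of
# places gives EVERY sign pattern; then EVERY polarisation type occurs on `ℂ^Φ/D(𝔪)`, for every CM type `Φ`, and
# THEOREM L (i) FAILS (a unit of `K⁺` of norm `−1`)

research route conditional on HC_CM; not a corollary; Q11.4-sentence-2 already refuted in dim ≥ 3.

Ring 2, WEIL-TYPE FAMILY-COVERAGE CENSUS (`HOME/WEIL-FAMILY-COVERAGE.md` `## b01`, blocks b01.28 THEOREM L, b01.41–42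
(the norm-sign law); owner ring2-b01), part 60 of the `Ring2WeilCoverage*` series.  Parts 2/55/55b proved, for ANY CM
field `K`, CM type `Φ`, lattice `𝔪` and type `𝔣₀`: under THEOREM L (i) (`hN`: every unit of `𝓞 K⁺` has positive norm)
and THEOREM L (ii) on `Φ` (`hU'`: every EVEN sign pattern on `Φ` is a real unit's), «type `𝔣₀` occurs on `ℂ^Φ/D(𝔪)`»
⟺ an even count — a TWO-SIDED law.  This file is the complementary regime: if THEOREM L (ii) holds on `Φ` and SOME
real unit `u₁` is negative at an ODD number of `φ ∈ Φ` (equivalently, by part 55 §3, `N_{K⁺/ℚ}(u₁) = −1`: THEOREM L (i)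
FAILS), then

* §1 **`forall_exists_units_sign_eq_of_odd`** — EVERY sign pattern `S ⊆ Φ` is a real unit's (the unit group of
  `K⁺` has every signature): for `|S|` odd take `u₁·u₂` with `u₂` the unit of the even pattern `S ∆ neg(u₁)`;
* §2 **`exists_pos_isOfType_of_forall_sign`** — under «every pattern on `Φ`» EVERY type `𝔣₀` that is the type of some
  skew `ζ₀ ≠ 0` OCCURS on `ℂ^Φ/D(𝔪)` (a `Φ`-positive `ζ = uζ₀` of type `𝔣₀`; part 2's criterion with no parity
  condition), with the corollaries `exists_pos_isOfType_realMul_of_forall_sign` (type `(ϖ₀)𝔣₀`, every real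
  `ϖ₀ ∈ 𝓞 K⁺ ∖ 0`), `exists_pos_isOfType_span_of_forall_sign` (every principal type `(ϖ₀)`) and, on the cyclotomic
  principal torus `ℂ^Φ/Φ(ℤ[ζₙ])`, **`exists_type_span_of_forall_sign`**: EVERY principal type `(ϖ₀)` occurs, for
  every `Φ` — no balance condition, no norm sign;
* §3 **`exists_realUnits_norm_neg_of_forall_sign`** — «every pattern on `Φ`» ⟹ some unit `v` of `𝓞 K⁺` has
  `N_{K⁺/ℚ}(v) < 0`: THEOREM L (i) fails for `K` (part 55 `norm_neg_iff_odd_ncard` on the singleton pattern).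

Part 61 discharges the odd unit at the census level `M = 32` (`ℚ(ζ₃₂)⁺`: the geometric-sum units have full sign rank,
part 22), so the two one-sided YES rows `(32, ℚ(i))`, `(32, ℚ(√−2))` of part 56d become: EVERY type occurs.

HONEST FRAMING: torus-level statements about Shimura's divisors `X_ζ` of type `(K; Φ; 𝔣₀)` [Sh98 §14.3 Prop. 4–5]
and signs of real units; nothing here is a statement about Hodge classes, `W_K`, general members or HC; `HC_CM` is
used nowhere.  No `def`, no named fact, no `sorry`.

References: [cite: Shimura1998, §14.3 Prop. 4–5, pp. 103–104]; census b01.28 / b01.42 (seat-derived).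
-/

noncomputable section

open scoped Classical nonZeroDivisors NumberField ComplexConjugate
open NumberField NumberField.ComplexEmbedding Module FractionalIdeal Complex Polynomial

namespace Summit.HodgeConjecture.Ring2WeilCoverage.FullSignature

open Literature.AlgebraicGeometry.Motives (CMType)
open Literature.NumberTheory.ComplexMultiplication
open Literature.NumberTheory.ComplexMultiplication.CMTypeLattice
open Summit.HodgeConjecture.Ring2WeilCoverage.CMTypeSignParity
open Summit.HodgeConjecture.Ring2WeilCoverage.CMUnitSignature
open Summit.HodgeConjecture.Ring2WeilCoverage.TypeNormSign

section General

variable {K : Type} [Field K] [NumberField K] [IsCMField K] (Φ : CMType K)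
  (𝔪 : (FractionalIdeal (𝓞 K)⁰ K)ˣ) {ζ₀ : K} {𝔣₀ : Ideal (𝓞 (maximalRealSubfield K))}

/-- the image in `K` of an integer `ϖ₀` of the maximal real subfield. -/
local notation3 (prettyPrint := false) "𝓇 " x:max => (algebraMap (𝓞 (maximalRealSubfield K)) K x)

/-! ### §1 THEOREM L (ii) + one odd unit ⟹ every sign pattern -/

/-- `Re (u₁u₂)^φ = Re u₁^φ · Re u₂^φ` for real `u₁, u₂` (both `φ`-values are real).
research route conditional on HC_CM; not a corollary; Q11.4-sentence-2 already refuted in dim ≥ 3. [folklore] -/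
theorem re_embedding_mul_of_real {u₁ u₂ : K} (hu₁ : IsCMField.complexConj K u₁ = u₁)
    (hu₂ : IsCMField.complexConj K u₂ = u₂) (φ : K →+* ℂ) :
    (φ (u₁ * u₂)).re = (φ u₁).re * (φ u₂).re := by
  rw [map_mul, Complex.mul_re, im_embedding_eq_zero_of_complexConj_eq hu₁ φ,
    im_embedding_eq_zero_of_complexConj_eq hu₂ φ, mul_zero, sub_zero]

/-- **FULL SIGNATURE from THEOREM L (ii) and ONE ODD UNIT.**  If every EVEN sign pattern on the CM type `Φ` is the
pattern of a unit of `𝓞 K` fixed by `ρ` (`hU'`, THEOREM L (ii) on `Φ`) and some unit `u₁` fixed by `ρ` is negative at an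
ODD number of `φ ∈ Φ`, then EVERY `S ⊆ Φ` is a pattern: there is a unit `u` fixed by `ρ` with `Re φ(u) < 0 ↔ φ ∈ S` on
`Φ`.  (For `|S|` odd: `u = u₁u₂` with `u₂` realising the even pattern `{φ ∈ Φ : ¬(φ ∈ S ↔ Re φ(u₁) < 0)}`.)
research route conditional on HC_CM; not a corollary; Q11.4-sentence-2 already refuted in dim ≥ 3. [folklore] -/
theorem forall_exists_units_sign_eq_of_odd
    (hU' : ∀ S : Set (K →+* ℂ), S ⊆ Φ.1 → Even S.ncard →
      ∃ u : (𝓞 K)ˣ, IsCMField.complexConj K ((u : 𝓞 K) : K) = ((u : 𝓞 K) : K) ∧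
        ∀ φ ∈ Φ.1, ((φ ((u : 𝓞 K) : K)).re < 0 ↔ φ ∈ S))
    {u₁ : (𝓞 K)ˣ} (hu₁ : IsCMField.complexConj K ((u₁ : 𝓞 K) : K) = ((u₁ : 𝓞 K) : K))
    (hodd : Odd ((Φ.1 ∩ {ψ : K →+* ℂ | (ψ ((u₁ : 𝓞 K) : K)).re < 0}).ncard))
    (S : Set (K →+* ℂ)) (hS : S ⊆ Φ.1) :
    ∃ u : (𝓞 K)ˣ, IsCMField.complexConj K ((u : 𝓞 K) : K) = ((u : 𝓞 K) : K) ∧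
      ∀ φ ∈ Φ.1, ((φ ((u : 𝓞 K) : K)).re < 0 ↔ φ ∈ S) := by
  rcases Nat.even_or_odd S.ncard with hev | hSodd
  · exact hU' S hS hev
  · -- the even pattern `S₂ = {φ ∈ Φ : ¬(φ ∈ S ↔ Re φ(u₁) < 0)}`
    set S₂ : Set (K →+* ℂ) := Φ.1 ∩ {ψ | ¬ (ψ ∈ S ↔ (ψ ((u₁ : 𝓞 K) : K)).re < 0)} with hS₂
    have hS₂Φ : S₂ ⊆ Φ.1 := Set.inter_subset_left
    have hSΦ : (Φ.1 ∩ {ψ : K →+* ℂ | ψ ∈ S}).ncard = S.ncard := by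
      congr 1
      ext ψ
      exact ⟨fun h => h.2, fun h => ⟨hS h, h⟩⟩
    have hev₂ : Even S₂.ncard := by
      have h := card_filter_not_iff_mod_two (Finset.univ : Finset Φ.1) (fun φ => φ.1 ∈ S)
        (fun φ => (φ.1 ((u₁ : 𝓞 K) : K)).re < 0)
      have e2 : (Finset.univ.filter fun φ : Φ.1 => φ.1 ∈ S).card = S.ncard := by
        rw [← hSΦ]
        convert card_filter_subtype_eq_ncard Φ (fun ψ => ψ ∈ S) using 3
      have e3 : (Finset.univ.filter fun φ : Φ.1 => (φ.1 ((u₁ : 𝓞 K) : K)).re < 0).card =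
          (Φ.1 ∩ {ψ : K →+* ℂ | (ψ ((u₁ : 𝓞 K) : K)).re < 0}).ncard := by
        convert card_filter_subtype_eq_ncard Φ (fun ψ => (ψ ((u₁ : 𝓞 K) : K)).re < 0) using 3
      have e1 : (Finset.univ.filter fun φ : Φ.1 => ¬ (φ.1 ∈ S ↔ (φ.1 ((u₁ : 𝓞 K) : K)).re < 0)).card =
          S₂.ncard := by
        rw [hS₂]
        convert card_filter_subtype_eq_ncard Φ (fun ψ => ¬ (ψ ∈ S ↔ (ψ ((u₁ : 𝓞 K) : K)).re < 0)) using 3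
      rw [e1, e2, e3] at h
      rw [Nat.even_iff, h, Nat.add_mod, Nat.odd_iff.mp hSodd, Nat.odd_iff.mp hodd]
    obtain ⟨u₂, hu₂, hsign₂⟩ := hU' S₂ hS₂Φ hev₂
    refine ⟨u₁ * u₂, ?_, fun φ hφ => ?_⟩
    · push_cast
      rw [map_mul, hu₁, hu₂]
    · have hre₁ := re_embedding_ne_zero_of_real hu₁ (coe_units_ne_zero u₁) φ
      have hre₂ := re_embedding_ne_zero_of_real hu₂ (coe_units_ne_zero u₂) φ
      have h2 : (φ ((u₂ : 𝓞 K) : K)).re < 0 ↔ ¬ (φ ∈ S ↔ (φ ((u₁ : 𝓞 K) : K)).re < 0) := by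
        rw [hsign₂ φ hφ, hS₂]
        exact ⟨fun h => h.2, fun h => ⟨hφ, h⟩⟩
      push_cast
      rw [re_embedding_mul_of_real hu₁ hu₂ φ, mul_neg_iff_not_iff hre₁ hre₂, h2]
      tauto

/-! ### §2 Every pattern ⟹ every type occurs -/

/-- **EVERY PATTERN ⟹ EVERY TYPE OCCURS.**  If every `S ⊆ Φ` is the sign pattern of a unit of `𝓞 K` fixed by `ρ`
(§1), then for every skew `ζ₀ ≠ 0` of type `𝔣₀` on `D(𝔪)` (`IsOfType 𝔪 ζ₀ 𝔣₀`) the CM torus `ℂ^Φ/D(𝔪)` carries a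
`Φ`-POSITIVE divisor of type `(K; Φ; 𝔣₀)`: `ζ = uζ₀` with `u` the unit of the pattern `{φ ∈ Φ : Im ζ₀^φ < 0}`
(part 2's criterion `exists_pos_isOfType_iff_exists_units`, `Im (uζ₀)^φ = Re u^φ · Im ζ₀^φ`).
research route conditional on HC_CM; not a corollary; Q11.4-sentence-2 already refuted in dim ≥ 3. [cite: Shimura1998, §14.3 Prop. 5, p. 104] -/
theorem exists_pos_isOfType_of_forall_sign (hζ₀ : IsCMField.complexConj K ζ₀ = -ζ₀) (h0 : ζ₀ ≠ 0)
    (hT : IsOfType 𝔪 ζ₀ 𝔣₀)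
    (hU : ∀ S : Set (K →+* ℂ), S ⊆ Φ.1 →
      ∃ u : (𝓞 K)ˣ, IsCMField.complexConj K ((u : 𝓞 K) : K) = ((u : 𝓞 K) : K) ∧
        ∀ φ ∈ Φ.1, ((φ ((u : 𝓞 K) : K)).re < 0 ↔ φ ∈ S)) :
    ∃ ζ : K, IsCMField.complexConj K ζ = -ζ ∧ (∀ φ : Φ.1, 0 < (φ.1 ζ).im) ∧ IsOfType 𝔪 ζ 𝔣₀ := by
  obtain ⟨u, hu, hsign⟩ := hU (Φ.1 ∩ {ψ : K →+* ℂ | (ψ ζ₀).im < 0}) Set.inter_subset_left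
  refine (exists_pos_isOfType_iff_exists_units Φ 𝔪 hζ₀ h0 hT).mpr ⟨u, hu, fun φ => ?_⟩
  have hre := re_embedding_ne_zero_of_real hu (coe_units_ne_zero u) φ.1
  have him := im_embedding_ne_zero_of_skew hζ₀ h0 φ.1
  have hiff : (φ.1 ((u : 𝓞 K) : K)).re < 0 ↔ (φ.1 ζ₀).im < 0 := by
    rw [hsign φ.1 φ.2]
    simp only [Set.mem_inter_iff, Set.mem_setOf_eq]
    exact ⟨fun h => h.2, fun h => ⟨φ.2, h⟩⟩
  rcases lt_or_gt_of_ne him with hlt | hgt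
  · exact mul_pos_of_neg_of_neg (hiff.mpr hlt) hlt
  · have hre' : 0 < (φ.1 ((u : 𝓞 K) : K)).re :=
      lt_of_le_of_ne (not_lt.mp fun h => (lt_asymm (hiff.mp h)) hgt) hre.symm
    exact mul_pos hre' hgt

/-- **Every pattern ⟹ type `(ϖ₀)𝔣₀` occurs** for every real `ϖ₀ ∈ 𝓞 K⁺ ∖ 0`, whatever the sign of `N_{K⁺/ℚ}(ϖ₀)`
(§2 with the skew `ϖζ₀` of type `(ϖ₀)𝔣₀`, part 55 `isOfType_realMul`).
research route conditional on HC_CM; not a corollary; Q11.4-sentence-2 already refuted in dim ≥ 3. [cite: Shimura1998, §14.3 Prop. 4–5, pp. 103–104] -/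
theorem exists_pos_isOfType_realMul_of_forall_sign (hζ₀ : IsCMField.complexConj K ζ₀ = -ζ₀) (h0 : ζ₀ ≠ 0)
    (hT : IsOfType 𝔪 ζ₀ 𝔣₀) {ϖ₀ : 𝓞 (maximalRealSubfield K)} (hϖ0 : ϖ₀ ≠ 0)
    (hU : ∀ S : Set (K →+* ℂ), S ⊆ Φ.1 →
      ∃ u : (𝓞 K)ˣ, IsCMField.complexConj K ((u : 𝓞 K) : K) = ((u : 𝓞 K) : K) ∧
        ∀ φ ∈ Φ.1, ((φ ((u : 𝓞 K) : K)).re < 0 ↔ φ ∈ S)) :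
    ∃ ζ : K, IsCMField.complexConj K ζ = -ζ ∧ (∀ φ : Φ.1, 0 < (φ.1 ζ).im) ∧
        IsOfType 𝔪 ζ (Ideal.span {ϖ₀} * 𝔣₀) :=
  exists_pos_isOfType_of_forall_sign Φ 𝔪 (complexConj_realMul ϖ₀ hζ₀)
    (mul_ne_zero (algebraMap_ringOfIntegers_ne_zero hϖ0) h0) (isOfType_realMul 𝔪 ϖ₀ hT) hU

/-- **Every pattern ⟹ every PRINCIPAL type `(ϖ₀)` occurs** on `ℂ^Φ/D(𝔪)`, given a skew `ζ₀ ≠ 0` with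
`IsOfType 𝔪 ζ₀ ⊤` (e.g. a skew generator of `(𝔡𝔪𝔪^ρ)⁻¹`): for EVERY real `ϖ₀ ∈ 𝓞 K⁺ ∖ 0`.
research route conditional on HC_CM; not a corollary; Q11.4-sentence-2 already refuted in dim ≥ 3. [cite: Shimura1998, §14.3 Prop. 4–5, pp. 103–104] -/
theorem exists_pos_isOfType_span_of_forall_sign (hζ₀ : IsCMField.complexConj K ζ₀ = -ζ₀) (h0 : ζ₀ ≠ 0)
    (hT : IsOfType 𝔪 ζ₀ ⊤) {ϖ₀ : 𝓞 (maximalRealSubfield K)} (hϖ0 : ϖ₀ ≠ 0)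
    (hU : ∀ S : Set (K →+* ℂ), S ⊆ Φ.1 →
      ∃ u : (𝓞 K)ˣ, IsCMField.complexConj K ((u : 𝓞 K) : K) = ((u : 𝓞 K) : K) ∧
        ∀ φ ∈ Φ.1, ((φ ((u : 𝓞 K) : K)).re < 0 ↔ φ ∈ S)) :
    ∃ ζ : K, IsCMField.complexConj K ζ = -ζ ∧ (∀ φ : Φ.1, 0 < (φ.1 ζ).im) ∧
        IsOfType 𝔪 ζ (Ideal.span {ϖ₀}) := by
  have h := exists_pos_isOfType_realMul_of_forall_sign Φ 𝔪 hζ₀ h0 hT hϖ0 hU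
  rwa [Ideal.mul_top] at h

/-! ### §3 Every pattern ⟹ THEOREM L (i) fails -/

/-- **Every pattern on some CM type ⟹ a unit of `𝓞 K⁺` of NEGATIVE norm** (THEOREM L (i) FAILS for `K`): the real
unit negative at exactly one `φ₀ ∈ Φ` is (the image of) a unit `v` of `𝓞 K⁺` (Mathlib
`IsCMField.Units.complexConj_eq_self_iff`) with `#{φ ∈ Φ : Re v^φ < 0} = 1` odd, i.e. `N_{K⁺/ℚ}(v) < 0` (part 55
`norm_neg_iff_odd_ncard`).
research route conditional on HC_CM; not a corollary; Q11.4-sentence-2 already refuted in dim ≥ 3. [folklore] -/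
theorem exists_realUnits_norm_neg_of_forall_sign
    (hU : ∀ S : Set (K →+* ℂ), S ⊆ Φ.1 →
      ∃ u : (𝓞 K)ˣ, IsCMField.complexConj K ((u : 𝓞 K) : K) = ((u : 𝓞 K) : K) ∧
        ∀ φ ∈ Φ.1, ((φ ((u : 𝓞 K) : K)).re < 0 ↔ φ ∈ S)) :
    ∃ v : (𝓞 (maximalRealSubfield K))ˣ,
      Algebra.norm ℚ (((v : 𝓞 (maximalRealSubfield K)) : maximalRealSubfield K)) < 0 := by
  -- a member `φ₀` of `Φ` (every embedding or its conjugate lies in `Φ`)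
  obtain ⟨ψ⟩ := (inferInstance : Nonempty (K →+* ℂ))
  obtain ⟨φ₀, hφ₀⟩ : ∃ φ₀ : K →+* ℂ, φ₀ ∈ Φ.1 := by
    by_cases hψ : ψ ∈ Φ.1
    · exact ⟨ψ, hψ⟩
    · exact ⟨conjugate ψ, not_not.mp fun h => hψ ((Φ.2 ψ).mpr h)⟩
  obtain ⟨u, hu, hsign⟩ := hU {φ₀} (Set.singleton_subset_iff.mpr hφ₀)
  obtain ⟨v, hv⟩ := (IsCMField.Units.complexConj_eq_self_iff K u).mp hu
  refine ⟨v, ?_⟩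
  have hv0 : (v : 𝓞 (maximalRealSubfield K)) ≠ 0 := v.ne_zero
  have h1 : (algebraMap (𝓞 K) K) (u : 𝓞 K) = ((u : 𝓞 K) : K) := rfl
  have hv' : 𝓇 (v : 𝓞 (maximalRealSubfield K)) = ((u : 𝓞 K) : K) := by
    rw [← h1, ← hv, IsScalarTower.algebraMap_apply (𝓞 (maximalRealSubfield K)) (𝓞 K) K]
  rw [norm_neg_iff_odd_ncard Φ hv0, hv']
  have hset : Φ.1 ∩ {ψ : K →+* ℂ | (ψ ((u : 𝓞 K) : K)).re < 0} = {φ₀} := by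
    ext φ
    simp only [Set.mem_inter_iff, Set.mem_setOf_eq, Set.mem_singleton_iff]
    constructor
    · rintro ⟨hφ, hneg⟩
      exact (hsign φ hφ).mp hneg
    · intro h
      rw [h]
      exact ⟨hφ₀, (hsign φ₀ hφ₀).mpr (Set.mem_singleton φ₀)⟩
  rw [hset, Set.ncard_singleton]
  exact odd_one

end General

/-! ### §4 The cyclotomic principal torus `ℂ^Φ/Φ(ℤ[ζₙ])`: every principal type -/

section Cyclotomic

open Summit.HodgeConjecture.Ring2WeilCoverage.CyclotomicDifferent
open Summit.HodgeConjecture.Ring2WeilCoverage.CyclotomicPrincipalObstruction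

variable {K : Type} [Field K] [NumberField K] {n : ℕ} [NeZero n] {ζ : K}

/-- **Every pattern ⟹ EVERY principal type `(ϖ₀)` occurs on `ℂ^Φ/Φ(ℤ[ζₙ])`** (`𝔪 = 1`, reference
`ξ_k = ζ^k/Φₙ′(ζ)` with `IsOfType 1 ξ_k ⊤`, part 6′): for every CM type `Φ` of `ℚ(ζₙ)` on which every sign pattern is a
real unit's and EVERY real `ϖ₀ ∈ 𝓞 K⁺ ∖ 0` there is a skew `Φ`-positive `ζ′` with `IsOfType 1 ζ′ (ϖ₀)` — an
`ι`-compatible polarisation of degree `|N_{K⁺/ℚ}(ϖ₀)|`, whatever the sign of the norm and whether or not `Φ` is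
balanced.
research route conditional on HC_CM; not a corollary; Q11.4-sentence-2 already refuted in dim ≥ 3. [cite: Shimura1998, §14.3 Prop. 4–5, pp. 103–104] -/
theorem exists_type_span_of_forall_sign [IsCyclotomicExtension {n} ℚ K] [IsCMField K] (hζ : IsPrimitiveRoot ζ n)
    {k : ℕ} (hg : Nat.totient n = 2 * (k + 1)) (Φ : CMType K) {ϖ₀ : 𝓞 (maximalRealSubfield K)} (hϖ0 : ϖ₀ ≠ 0)
    (hU : ∀ S : Set (K →+* ℂ), S ⊆ Φ.1 →
      ∃ u : (𝓞 K)ˣ, IsCMField.complexConj K ((u : 𝓞 K) : K) = ((u : 𝓞 K) : K) ∧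
        ∀ φ ∈ Φ.1, ((φ ((u : 𝓞 K) : K)).re < 0 ↔ φ ∈ S)) :
    ∃ ζ' : K, IsCMField.complexConj K ζ' = -ζ' ∧ (∀ φ : Φ.1, 0 < (φ.1 ζ').im) ∧
        IsOfType (1 : (FractionalIdeal (𝓞 K)⁰ K)ˣ) ζ' (Ideal.span {ϖ₀}) :=
  exists_pos_isOfType_span_of_forall_sign Φ 1 (complexConj_xi hζ hg) (xi_ne_zero hζ k)
    (isOfType_one_xi_top hζ k) hϖ0 hU

/-- **Every pattern ⟹ a principal polarisation AND every principal type** on `ℂ^Φ/Φ(ℤ[ζₙ])`: the case `ϖ₀ = 1`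
(`IsOfType 1 ζ′ ⊤`).
research route conditional on HC_CM; not a corollary; Q11.4-sentence-2 already refuted in dim ≥ 3. [cite: Shimura1998, §14.3 Prop. 5, p. 104] -/
theorem exists_principal_of_forall_sign [IsCyclotomicExtension {n} ℚ K] [IsCMField K] (hζ : IsPrimitiveRoot ζ n)
    {k : ℕ} (hg : Nat.totient n = 2 * (k + 1)) (Φ : CMType K)
    (hU : ∀ S : Set (K →+* ℂ), S ⊆ Φ.1 →
      ∃ u : (𝓞 K)ˣ, IsCMField.complexConj K ((u : 𝓞 K) : K) = ((u : 𝓞 K) : K) ∧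
        ∀ φ ∈ Φ.1, ((φ ((u : 𝓞 K) : K)).re < 0 ↔ φ ∈ S)) :
    ∃ ζ' : K, IsCMField.complexConj K ζ' = -ζ' ∧ (∀ φ : Φ.1, 0 < (φ.1 ζ').im) ∧
        IsOfType (1 : (FractionalIdeal (𝓞 K)⁰ K)ˣ) ζ' ⊤ :=
  exists_pos_isOfType_of_forall_sign Φ 1 (complexConj_xi hζ hg) (xi_ne_zero hζ k) (isOfType_one_xi_top hζ k) hU

end Cyclotomic

end Summit.HodgeConjecture.Ring2WeilCoverage.FullSignature

end
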